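import Summits.HodgeConjecture.HodgeConjecture.Theorems.PadicSemiregularLiftHodgeAbelianVarietiesAndreMaskedComponent
import Summits.HodgeConjecture.HodgeConjecture.Theorems.PadicSemiregularLiftHodgeAbelianVarietiesAndreEsymmCriterion
import HarnessLib

/-!
# COR-CM (cell `pub-hodgecm2`), A1 line (cyclic sextic faces from Markman) — linear-algebra helpers:
# isotypic components inside an invariant subspace, and a generic natural shift separating products

HONEST FRAMING (cell pub-hodgecm2 / COR-CM, seat b30 gen 11; COUNT-NEUTRAL — no binder row of
`HOME/BINDER-OWNERS.md`, no case of the Hodge conjecture, nothing about algebraic cycles): two pieces of pure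
linear algebra used by step L5 of `HOME/pub-hodgecm2-lit-andre-3/A1-BLUEPRINT.md` ("pull-back span and
grading"), where a subspace `V ⊆ H⁴(P(ℂ); ℂ)` of algebraic classes stable under the diagonal CM action is shown
to contain the face monomial by projecting a pulled-back Weil class onto a joint eigenline.

* `sum_repr_smul_mem_of_invariant` — if an operator `T` is DIAGONAL in a basis `B` (`T (B j) = λ_j • B j`) and
  a subspace `W` is `T`-stable, then for every `v ∈ W` and every scalar `μ` the `μ`-isotypic component
  `Σ_{λ_j = μ} (B.repr v j) • B j` lies in `W` (apply `∏_{μ' ≠ μ} (T - μ')`, Lagrange).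
* `exists_nat_forall_prod_add_natCast_ne` — for finitely many multisets `M_i ≠ N` of complex numbers there is a
  natural number `t` with `∏_{m ∈ M_i} (m + t) ≠ ∏_{n ∈ N} (n + t)` for all `i` (the monic polynomials
  `∏ (X + m)` are determined by their roots, so each coincidence set is finite).

THEOREMS ONLY (no `def`); no `sorry`; axioms `propext`, `Classical.choice`, `Quot.sound`.

## References
* [Lang2002] S. Lang, *Algebra*, 3rd ed. (2002), XIV §2 (invariant subspaces of a diagonalisable
  operator are sums of their intersections with the eigenspaces) and IV §1 (a polynomial is determined by its roots).
-/

noncomputable section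

namespace Summit.HodgeConjecture.CorCM.InvariantComponent

open Summit.HodgeConjecture.HodgeConjecture.Theorems.HodgeAbelianVarieties.CMPivotAndre

/-! ## Isotypic components of a vector of an invariant subspace, for a diagonal operator -/

section Diagonal

variable {F V J : Type*} [Field F] [AddCommGroup V] [Module F V] [Fintype J]

/-- One Lagrange factor: if `w ∈ W`, `W` is `T`-stable and `T` is diagonal on `B` with eigenvalues `lam`,
then `T w - μ' • w ∈ W` and its `j`-th coordinate is `(lam j - μ') * (B.repr w j)`. [folklore] -/
theorem repr_apply_sub_smul (B : Module.Basis J F V) (T : V →ₗ[F] V) (lam : J → F)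
    (hT : ∀ j, T (B j) = lam j • B j) (μ' : F) (w : V) (j : J) :
    B.repr (T w - μ' • w) j = (lam j - μ') * B.repr w j := by
  rw [map_sub, map_smul, Finsupp.sub_apply, Finsupp.smul_apply, repr_apply_of_diagonal B T lam hT w j,
    smul_eq_mul, sub_mul]

/-- The Lagrange product: for every finite set `Λ'` of scalars there is `w ∈ W` whose coordinates are
`(∏_{μ' ∈ Λ'} (lam j - μ')) * (B.repr v j)` (namely `w = ∏_{μ' ∈ Λ'} (T - μ') v`). [cite: Lang2002, XIV §2] -/
theorem exists_mem_repr_eq_prod_mul (B : Module.Basis J F V) (T : V →ₗ[F] V) (lam : J → F)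
    (hT : ∀ j, T (B j) = lam j • B j) (W : Submodule F V) (hW : ∀ v ∈ W, T v ∈ W) {v : V} (hv : v ∈ W)
    (Λ' : Finset F) :
    ∃ w ∈ W, ∀ j, B.repr w j = (∏ μ' ∈ Λ', (lam j - μ')) * B.repr v j := by
  classical
  induction Λ' using Finset.induction_on with
  | empty => exact ⟨v, hv, fun j => by rw [Finset.prod_empty, one_mul]⟩
  | insert μ' Λ' hμ' ih =>
    obtain ⟨w, hwW, hw⟩ := ih
    refine ⟨T w - μ' • w, W.sub_mem (hW w hwW) (W.smul_mem μ' hwW), fun j => ?_⟩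
    rw [repr_apply_sub_smul B T lam hT μ' w j, hw j, Finset.prod_insert hμ', mul_assoc]

/-- **Isotypic components stay in an invariant subspace.** Let `T` be diagonal in the finite basis `B`
(`T (B j) = lam j • B j`) and let `W` be a `T`-stable subspace. For `v ∈ W` and any scalar `μ`, the
`μ`-component `Σ_{j : lam j = μ} (B.repr v j) • B j` of `v` lies in `W`. [cite: Lang2002, XIV §2] -/
theorem sum_repr_smul_mem_of_invariant [DecidableEq F] (B : Module.Basis J F V) (T : V →ₗ[F] V)
    (lam : J → F) (hT : ∀ j, T (B j) = lam j • B j) (W : Submodule F V) (hW : ∀ v ∈ W, T v ∈ W)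
    {v : V} (hv : v ∈ W) (μ : F) :
    (∑ j ∈ Finset.univ.filter (fun j => lam j = μ), B.repr v j • B j) ∈ W := by
  classical
  -- the other eigenvalues
  set Λ' : Finset F := (Finset.univ.image lam).erase μ with hΛ'
  obtain ⟨w, hwW, hw⟩ := exists_mem_repr_eq_prod_mul B T lam hT W hW hv Λ'
  set c : F := ∏ μ' ∈ Λ', (μ - μ') with hc
  have hc0 : c ≠ 0 := by
    refine Finset.prod_ne_zero_iff.mpr fun μ' hμ' => sub_ne_zero.mpr ?_
    exact (Finset.ne_of_mem_erase hμ').symm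
  -- `w = c • (μ-component of v)`
  have hwc : w = c • ∑ j ∈ Finset.univ.filter (fun j => lam j = μ), B.repr v j • B j := by
    refine B.ext_elem fun j => ?_
    rw [hw j, map_smul, Finsupp.smul_apply, repr_sum_smul_basis_apply, smul_eq_mul]
    split_ifs with hmem
    · rw [(Finset.mem_filter.mp hmem).2]
    · have hj : lam j ≠ μ := fun h => hmem (Finset.mem_filter.mpr ⟨Finset.mem_univ j, h⟩)
      have hmem' : lam j ∈ Λ' := by
        rw [hΛ']
        exact Finset.mem_erase.mpr ⟨hj, Finset.mem_image_of_mem lam (Finset.mem_univ j)⟩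
      rw [Finset.prod_eq_zero hmem' (sub_self _), zero_mul, mul_zero]
  have h := W.smul_mem c⁻¹ hwW
  rwa [hwc, smul_smul, inv_mul_cancel₀ hc0, one_smul] at h

/-- **Corollary: a basis line with a unique eigenvalue.** If moreover the eigenvalue `lam j₀` is attained
at `j₀` only, then `(B.repr v j₀) • B j₀ ∈ W` for every `v ∈ W`; in particular `B j₀ ∈ W` as soon as some
`v ∈ W` has a non-zero `j₀`-coordinate. [cite: Lang2002, XIV §2] -/
theorem repr_smul_basis_mem_of_invariant (B : Module.Basis J F V) (T : V →ₗ[F] V) (lam : J → F)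
    (hT : ∀ j, T (B j) = lam j • B j) (W : Submodule F V) (hW : ∀ v ∈ W, T v ∈ W) {v : V} (hv : v ∈ W)
    (j₀ : J) (hj₀ : ∀ j, lam j = lam j₀ → j = j₀) : B.repr v j₀ • B j₀ ∈ W := by
  classical
  have h := sum_repr_smul_mem_of_invariant B T lam hT W hW hv (lam j₀)
  have hfilter : Finset.univ.filter (fun j => lam j = lam j₀) = {j₀} := by
    ext j
    simp only [Finset.mem_filter, Finset.mem_univ, true_and, Finset.mem_singleton]
    exact ⟨hj₀ j, fun h => by rw [h]⟩
  rwa [hfilter, Finset.sum_singleton] at h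

/-- The form used by the A1 line: `B j₀ ∈ W` when some `v ∈ W` has `B.repr v j₀ ≠ 0`.
[cite: Lang2002, XIV §2] -/
theorem basis_mem_of_invariant_of_repr_ne_zero (B : Module.Basis J F V) (T : V →ₗ[F] V) (lam : J → F)
    (hT : ∀ j, T (B j) = lam j • B j) (W : Submodule F V) (hW : ∀ v ∈ W, T v ∈ W) {v : V} (hv : v ∈ W)
    (j₀ : J) (hj₀ : ∀ j, lam j = lam j₀ → j = j₀) (hvj : B.repr v j₀ ≠ 0) : B j₀ ∈ W := by
  have h := W.smul_mem (B.repr v j₀)⁻¹ (repr_smul_basis_mem_of_invariant B T lam hT W hW hv j₀ hj₀)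
  rwa [smul_smul, inv_mul_cancel₀ hvj, one_smul] at h

end Diagonal

/-! ## A generic natural shift separating finitely many products `∏ (m + t)` -/

section Shift

open Polynomial

/-- The coincidence set of two distinct multisets is finite: if `M ≠ N` then only finitely many natural
numbers `t` satisfy `∏_{m ∈ M} (m + t) = ∏_{n ∈ N} (n + t)` (both sides are the values at `t` of the monic
polynomials `∏ (X + m)`, `∏ (X + n)`, which differ since their root multisets `-M ≠ -N` differ).
[cite: Lang2002, IV §1] -/
theorem finite_setOf_prod_add_natCast_eq {M N : Multiset ℂ} (hMN : M ≠ N) :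
    {t : ℕ | (M.map fun m => m + (t : ℂ)).prod = (N.map fun n => n + (t : ℂ)).prod}.Finite := by
  classical
  set p : ℂ[X] := (M.map fun m => X + C m).prod - (N.map fun n => X + C n).prod with hp
  have hp0 : p ≠ 0 := by
    intro h
    have heq : (M.map fun m => X + C m).prod = (N.map fun n => X + C n).prod := sub_eq_zero.mp h
    have hroots := congrArg Polynomial.roots heq
    rw [roots_multiset_prod_X_add_C, roots_multiset_prod_X_add_C] at hroots
    exact hMN (Multiset.map_injective neg_injective hroots)
  have heval : ∀ (S : Multiset ℂ) (t : ℕ),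
      ((S.map fun m => X + C m).prod).eval (t : ℂ) = (S.map fun m => m + (t : ℂ)).prod := by
    intro S t
    rw [Polynomial.eval_multiset_prod, Multiset.map_map]
    refine congrArg Multiset.prod (Multiset.map_congr rfl fun m _ => ?_)
    simp [add_comm]
  refine Set.Finite.subset ((p.roots.toFinset : Set ℂ).toFinite.preimage Nat.cast_injective.injOn) ?_
  intro t ht
  simp only [Set.mem_setOf_eq] at ht
  simp only [Set.mem_preimage, Finset.mem_coe, Multiset.mem_toFinset]
  rw [Polynomial.mem_roots hp0, Polynomial.IsRoot, hp, eval_sub, heval, heval, ht, sub_self]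

/-- **Generic natural shift.** For a finite family of multisets `M i` of complex numbers, all different from
`N`, some natural number `t` satisfies `∏_{m ∈ M i} (m + t) ≠ ∏_{n ∈ N} (n + t)` for every `i`.
[cite: Lang2002, IV §1] -/
theorem exists_nat_forall_prod_add_natCast_ne {I : Type*} [Finite I] (M : I → Multiset ℂ) (N : Multiset ℂ)
    (hM : ∀ i, M i ≠ N) :
    ∃ t : ℕ, ∀ i, (((M i).map fun m => m + (t : ℂ)).prod) ≠ (N.map fun n => n + (t : ℂ)).prod := by
  have hfin : {t : ℕ | ∃ i, ((M i).map fun m => m + (t : ℂ)).prod = (N.map fun n => n + (t : ℂ)).prod}.Finite := by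
    have h := Set.finite_iUnion fun i => finite_setOf_prod_add_natCast_eq (hM i)
    refine h.subset ?_
    intro t ht
    obtain ⟨i, hi⟩ := ht
    exact Set.mem_iUnion.mpr ⟨i, hi⟩
  obtain ⟨t, ht⟩ := hfin.exists_notMem
  exact ⟨t, fun i hi => ht ⟨i, hi⟩⟩

end Shift

end Summit.HodgeConjecture.CorCM.InvariantComponent

end
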